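import Summits.HodgeConjecture.CorCM.AbelianSixteenStabilisers
import HarnessLib

/-!
# Abelian groups of order `16` with squares in `{1, ρ}`, case (B): an odd character with a value `ω`, `ω² = −1`
# — a CM type equidistributed over it has a non-trivial stabiliser; the combined statement

COR-CM (cell `pub-hodgecm2`), binder seat b04 (gen 15), count-neutral claim ABELIAN-2POWER-CLASSIF, part IIb (pure
group theory, sequel of part IIa `CorCM/AbelianSixteenStabilisers`).  KERNEL ONLY: theorems; no definition, no
named fact, no `sorry`.

Case (B) of the analysis described in part IIa: `G` commutative of order `16`, every square `1` or `ρ`, `T` a CM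
type (`ρg ∈ T ↔ g ∉ T`) equidistributed over an odd character `χ` which takes a value `χ(γ) = ω ∉ {±1}`.  Then
`γ² = ρ`, `ω² = −1`, the values of `χ` are `1, ω, −1, −ω` with fibres `H, γH, ρH, ργH` (`H = ker χ`, a Klein
four-group), `|H| = 4` (`card_ker_eq_four`), and `A₀ = {h ∈ H : h ∈ T}`, `A₁ = {h ∈ H : γh ∈ T}` are `2`-subsets
(equidistribution at `1` and at `γ`).  By the `F₂²`-lemma (`AbelianSixteen.two_subset_stabiliser`) each `Aᵢ = {aᵢ, bᵢ}`
is stabilised by `uᵢ = aᵢbᵢ` and moved off itself by every `x ∉ {1, uᵢ}`; so either `u₀ = u₁` stabilises `T`, or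
`x = u₀u₁` exchanges each `Aᵢ` with `H ∖ Aᵢ` and `ρx` stabilises `T` (`exists_stabiliser_of_order_four_value`).

**`exists_stabiliser_sixteen`** (cases (A) of part IIa and (B) together): for `G` commutative of order `16` with all
squares in `{1, ρ}`, every CM type equidistributed over an odd character has a stabiliser `v ≠ 1` — hence (part IIc,
with part Ia's `ThinKernel.not_isPrimitive_of_forall_mem_iff` and gen 12's equidistribution criterion) no PRIMITIVE
CM type of an abelian CM field of degree `16` whose Galois automorphisms all square to `1` or to complex conjugation is
degenerate.

## References

* [Kubota1965] T. Kubota, *On the field extension by complex multiplication*, Trans. AMS 118 (1965), §4 Lemma 2.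
* [Shimura1998] G. Shimura, *Abelian Varieties with Complex Multiplication and Modular Functions*, §8.2 Prop. 26.
-/

noncomputable section

namespace Summit.HodgeConjecture.CorCM.AbelianSixteen

open Summit.HodgeConjecture.CorCM.ThinKernel (chi_eq_iff neg_chi_eq)

variable {G : Type*} [CommGroup G] [Fintype G] [DecidableEq G]

/-! ## §4 Fibres of a character are translates of the kernel -/

omit [DecidableEq G] in
/-- The part of `T` in the fibre `χ = χ(a)` is `a · {h ∈ ker χ : ah ∈ T}`. [folklore] -/
theorem card_filter_T_eq [DecidableEq G] (T : Finset G) (χ : AddChar (Additive G) ℂ) (a : G) :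
    (T.filter fun s => χ (Additive.ofMul s) = χ (Additive.ofMul a)).card =
      ((Finset.univ.filter fun h : G => χ (Additive.ofMul h) = 1).filter fun h => a * h ∈ T).card := by
  symm
  refine Finset.card_bij (fun h _ => a * h) (fun h hh => ?_) (fun h₁ _ h₂ _ h => mul_left_cancel h)
    (fun s hs => ?_)
  · simp only [Finset.mem_filter, Finset.mem_univ, true_and] at hh ⊢
    exact ⟨hh.2, by rw [ofMul_mul, AddChar.map_add_eq_mul, hh.1, mul_one]⟩
  · simp only [Finset.mem_filter, Finset.mem_univ, true_and] at hs ⊢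
    refine ⟨s * a⁻¹, ⟨(chi_eq_iff χ s a).1 hs.2, ?_⟩, ?_⟩
    · rw [mul_comm s, ← mul_assoc, mul_inv_cancel, one_mul]; exact hs.1
    · rw [mul_comm s, ← mul_assoc, mul_inv_cancel, one_mul]

omit [DecidableEq G] in
/-- Every fibre of `χ` has the size of the kernel. [folklore] -/
theorem card_fibre_eq [DecidableEq G] (χ : AddChar (Additive G) ℂ) (a : G) :
    (Finset.univ.filter fun g : G => χ (Additive.ofMul g) = χ (Additive.ofMul a)).card =
      (Finset.univ.filter fun h : G => χ (Additive.ofMul h) = 1).card := by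
  have h := card_filter_T_eq (Finset.univ : Finset G) χ a
  rw [h]
  congr 1
  exact Finset.filter_true_of_mem fun h _ => Finset.mem_univ _

omit [DecidableEq G] in
/-- **`|ker χ| = 4`** when `|G| = 16` and `χ` takes a value `ω = χ(γ)` with `ω ∉ {1, −1}` and all squares lie in
`{1, ρ}`, `χ(ρ) = −1`: the values of `χ` are exactly `1, ω, −1, −ω` (`χ(g)² = χ(g²) = ±1 = ` `1` or `ω²`), and the
four fibres are translates of the kernel. [folklore] -/
theorem card_ker_eq_four [DecidableEq G] {ρ γ : G} (hG : Fintype.card G = 16)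
    (hsq : ∀ g : G, g * g = 1 ∨ g * g = ρ) (χ : AddChar (Additive G) ℂ) (hχ : χ (Additive.ofMul ρ) = -1)
    (hγ1 : χ (Additive.ofMul γ) ≠ 1) (hγ2 : χ (Additive.ofMul γ) ≠ -1) :
    γ * γ = ρ ∧ χ (Additive.ofMul γ) ^ 2 = -1 ∧
      (∀ g : G, χ (Additive.ofMul g) = 1 ∨ χ (Additive.ofMul g) = χ (Additive.ofMul γ) ∨
        χ (Additive.ofMul g) = -1 ∨ χ (Additive.ofMul g) = -χ (Additive.ofMul γ)) ∧
      (Finset.univ.filter fun h : G => χ (Additive.ofMul h) = 1).card = 4 := by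
  set ω := χ (Additive.ofMul γ) with hω
  have hγγ : γ * γ = ρ := by
    rcases hsq γ with h1 | h2
    · exfalso
      have : ω ^ 2 = 1 := by rw [hω, chi_sq, h1, ofMul_one, AddChar.map_zero_eq_one]
      rcases sq_eq_one_iff.1 this with h | h
      · exact hγ1 h
      · exact hγ2 h
    · exact h2
  have hω2 : ω ^ 2 = -1 := by rw [hω, chi_sq, hγγ, hχ]
  have hvals : ∀ g : G, χ (Additive.ofMul g) = 1 ∨ χ (Additive.ofMul g) = ω ∨
      χ (Additive.ofMul g) = -1 ∨ χ (Additive.ofMul g) = -ω := by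
    intro g
    rcases hsq g with h1 | h2
    · have : χ (Additive.ofMul g) ^ 2 = 1 := by rw [chi_sq, h1, ofMul_one, AddChar.map_zero_eq_one]
      rcases sq_eq_one_iff.1 this with h | h
      · exact Or.inl h
      · exact Or.inr (Or.inr (Or.inl h))
    · have : χ (Additive.ofMul g) ^ 2 = ω ^ 2 := by rw [chi_sq, h2, hχ, hω2]
      rcases (sq_eq_sq_iff_eq_or_eq_neg).1 this with h | h
      · exact Or.inr (Or.inl h)
      · exact Or.inr (Or.inr (Or.inr h))
  refine ⟨hγγ, hω2, hvals, ?_⟩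
  -- count: `16 = Σ_{v ∈ {1, ω, -1, -ω}} |fibre(v)| = 4 |ker|`
  set Hf := Finset.univ.filter fun h : G => χ (Additive.ofMul h) = 1 with hHf
  have hω0 : ω ≠ 0 := (AddChar.val_isUnit χ (Additive.ofMul γ)).ne_zero
  have h1ω : (1 : ℂ) ≠ ω := fun h => hγ1 h.symm
  have h1m : (1 : ℂ) ≠ -1 := by norm_num
  have h1mω : (1 : ℂ) ≠ -ω := fun h => hγ2 (by rw [h, neg_neg])
  have hωm : ω ≠ -1 := hγ2
  have hωmω : ω ≠ -ω := fun h => hω0 (by linear_combination h / 2)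
  have hmmω : (-1 : ℂ) ≠ -ω := fun h => hγ1 (by have := neg_inj.1 h; exact this.symm)
  have hmaps : ((Finset.univ : Finset G) : Set G).MapsTo (fun g => χ (Additive.ofMul g))
      ({1, ω, -1, -ω} : Finset ℂ) := by
    intro g _
    simp only [Finset.coe_insert, Finset.coe_singleton, Set.mem_insert_iff, Set.mem_singleton_iff]
    exact hvals g
  have hsum := Finset.card_eq_sum_card_fiberwise hmaps
  rw [Finset.sum_insert (by simp [h1ω, h1m, h1mω]), Finset.sum_insert (by simp [hωm, hωmω]),
    Finset.sum_pair hmmω, Finset.card_univ, hG] at hsum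
  -- the four fibres have the size of the kernel
  have hf1 : (Finset.univ.filter fun g : G => χ (Additive.ofMul g) = 1).card = Hf.card := rfl
  have hfω : (Finset.univ.filter fun g : G => χ (Additive.ofMul g) = ω).card = Hf.card := card_fibre_eq χ γ
  have hfm : (Finset.univ.filter fun g : G => χ (Additive.ofMul g) = -1).card = Hf.card := by
    rw [← hχ]; exact card_fibre_eq χ ρ
  have hfmω : (Finset.univ.filter fun g : G => χ (Additive.ofMul g) = -ω).card = Hf.card := by
    rw [hω, neg_chi_eq χ hχ γ]; exact card_fibre_eq χ (ρ * γ)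
  rw [hf1, hfω, hfm, hfmω] at hsum
  omega

/-! ## §5 Case (B): a value `ω` with `ω² = −1` -/

omit [DecidableEq G] in
/-- **Case (B).**  `|G| = 16`, squares in `{1, ρ}`, `χ` odd with a value `χ(γ) ∉ {±1}`, `T` a CM type
equidistributed over `χ`: some `v ≠ 1` stabilises `T` (see the module docstring). [cite: Kubota1965, §4 Lemma 2] -/
theorem exists_stabiliser_of_order_four_value [DecidableEq G] {ρ γ : G} {T : Finset G}
    (hT : ∀ g : G, ρ * g ∈ T ↔ g ∉ T) (hρ2 : ρ * ρ = 1) (hG : Fintype.card G = 16)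
    (hsq : ∀ g : G, g * g = 1 ∨ g * g = ρ) (χ : AddChar (Additive G) ℂ) (hχ : χ (Additive.ofMul ρ) = -1)
    (hγ1 : χ (Additive.ofMul γ) ≠ 1) (hγ2 : χ (Additive.ofMul γ) ≠ -1)
    (hE : ∀ g : G, (T.filter fun s => χ (Additive.ofMul s) = χ (Additive.ofMul g)).card =
        (T.filter fun s => χ (Additive.ofMul s) = -χ (Additive.ofMul g)).card) :
    ∃ v : G, v ≠ 1 ∧ ∀ z : G, z ∈ T ↔ v * z ∈ T := by
  obtain ⟨hγγ, hω2, hvals, hH4⟩ := card_ker_eq_four hG hsq χ hχ hγ1 hγ2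
  set ω := χ (Additive.ofMul γ) with hω
  set Hf := Finset.univ.filter fun h : G => χ (Additive.ofMul h) = 1 with hHf
  have hmemHf : ∀ h, h ∈ Hf ↔ χ (Additive.ofMul h) = 1 := fun h => by simp [hHf]
  have hinvH : ∀ x, χ (Additive.ofMul x) = 1 → x * x = 1 := fun x hx =>
    sq_eq_one_of_chi_sq hsq χ hχ (by rw [hx, one_pow])
  have hχmul : ∀ a b : G, χ (Additive.ofMul (a * b)) = χ (Additive.ofMul a) * χ (Additive.ofMul b) :=
    fun a b => by rw [ofMul_mul, AddChar.map_add_eq_mul]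
  -- the two `2`-subsets `A₀ = {h ∈ H : h ∈ T}`, `A₁ = {h ∈ H : γh ∈ T}`
  set A₀ := Hf.filter fun h => (1 : G) * h ∈ T with hA₀
  set A₁ := Hf.filter fun h => γ * h ∈ T with hA₁
  have hmemA₀ : ∀ h, h ∈ A₀ ↔ χ (Additive.ofMul h) = 1 ∧ h ∈ T := fun h => by
    rw [hA₀, Finset.mem_filter, hmemHf, one_mul]
  have hmemA₁ : ∀ h, h ∈ A₁ ↔ χ (Additive.ofMul h) = 1 ∧ γ * h ∈ T := fun h => by
    rw [hA₁, Finset.mem_filter, hmemHf]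
  -- equidistribution at `1` and at `γ` ⟹ `|A₀| = |A₁| = 2`
  have hcount : ∀ a : G, (Hf.filter fun h => a * h ∈ T).card = 2 := by
    intro a
    have h := hE a
    rw [card_filter_T_eq T χ a, neg_chi_eq χ hχ a, card_filter_T_eq T χ (ρ * a)] at h
    have hswap : (Hf.filter fun h => ρ * a * h ∈ T) = Hf.filter fun h => ¬ a * h ∈ T :=
      Finset.filter_congr fun h _ => by rw [mul_assoc]; exact hT (a * h)
    rw [← hHf, hswap] at h
    have hsplit := Finset.card_filter_add_card_filter_not (s := Hf) (fun h => a * h ∈ T)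
    rw [hH4, ← h] at hsplit
    omega
  have hA₀2 : A₀.card = 2 := hcount 1
  have hA₁2 : A₁.card = 2 := hcount γ
  obtain ⟨u₀, hu₀1, hu₀u₀, hu₀A, hu₀off⟩ := two_subset_stabiliser A₀ hA₀2 fun x hx => hinvH x ((hmemA₀ x).1 hx).1
  obtain ⟨u₁, hu₁1, hu₁u₁, hu₁A, hu₁off⟩ := two_subset_stabiliser A₁ hA₁2 fun x hx => hinvH x ((hmemA₁ x).1 hx).1
  -- `uᵢ ∈ ker χ`
  have hker_of_stab : ∀ (A : Finset G) (u : G), (∀ x ∈ A, χ (Additive.ofMul x) = 1) → A.card = 2 →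
      (∀ z ∈ A, u * z ∈ A) → χ (Additive.ofMul u) = 1 := by
    intro A u hA hA2 huA
    obtain ⟨a, ha⟩ : ∃ a, a ∈ A := Finset.card_pos.1 (by rw [hA2]; norm_num)
    have h := hA _ (huA a ha)
    rwa [hχmul, hA a ha, mul_one] at h
  have hχu₀ : χ (Additive.ofMul u₀) = 1 := hker_of_stab A₀ u₀ (fun x hx => ((hmemA₀ x).1 hx).1) hA₀2 hu₀A
  have hχu₁ : χ (Additive.ofMul u₁) = 1 := hker_of_stab A₁ u₁ (fun x hx => ((hmemA₁ x).1 hx).1) hA₁2 hu₁A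
  -- inverses of the coset representatives: `ρ⁻¹ = ρ`, `z = γ (γ³ z)`, `χ(γ³ z) = -ω χ(z)`…; we use `h := a' * z`
  -- with `a * a' = 1` to land in the kernel.
  have hγ4 : γ * (γ * ρ) = 1 := by rw [← mul_assoc, hγγ, hρ2]
  -- generic verification scheme: a stabiliser candidate `v` with `v² = 1` and `z ∈ T → vz ∈ T`
  have finish : ∀ v : G, v ≠ 1 → v * v = 1 → (∀ z, z ∈ T → v * z ∈ T) →
      ∃ v : G, v ≠ 1 ∧ ∀ z : G, z ∈ T ↔ v * z ∈ T := fun v hv1 hvv key =>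
    ⟨v, hv1, fun z => ⟨key z, fun h => by have := key _ h; rwa [← mul_assoc, hvv, one_mul] at this⟩⟩
  -- decomposition of an arbitrary `z` along the four fibres: `z = a h` with `a ∈ {1, γ, ρ, ργ}`, `χ(h) = 1`
  have hdecomp : ∀ z : G, ∃ a h : G, (a = 1 ∨ a = γ ∨ a = ρ ∨ a = ρ * γ) ∧ χ (Additive.ofMul h) = 1 ∧
      z = a * h := by
    intro z
    rcases hvals z with h | h | h | h
    · exact ⟨1, z, Or.inl rfl, h, (one_mul z).symm⟩
    · refine ⟨γ, γ * ρ * z, Or.inr (Or.inl rfl), ?_, by rw [← mul_assoc, hγ4, one_mul]⟩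
      rw [hχmul, hχmul, hχ, h, ← hω]
      linear_combination -hω2
    · exact ⟨ρ, ρ * z, Or.inr (Or.inr (Or.inl rfl)), by rw [hχmul, hχ, h]; norm_num,
        by rw [← mul_assoc, hρ2, one_mul]⟩
    · refine ⟨ρ * γ, γ * z, Or.inr (Or.inr (Or.inr rfl)), by rw [hχmul, h, ← hω]; linear_combination -hω2, ?_⟩
      rw [show ρ * γ * (γ * z) = ρ * (γ * γ) * z by simp only [mul_assoc], hγγ, hρ2, one_mul]
  -- membership of `a h` in `T` in terms of `A₀`, `A₁` (`h ∈ ker χ`)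
  have hmem1 : ∀ h, χ (Additive.ofMul h) = 1 → ((1 : G) * h ∈ T ↔ h ∈ A₀) := fun h hh => by
    rw [hmemA₀, one_mul]; exact ⟨fun ht => ⟨hh, ht⟩, fun ht => ht.2⟩
  have hmemγ : ∀ h, χ (Additive.ofMul h) = 1 → (γ * h ∈ T ↔ h ∈ A₁) := fun h hh => by
    rw [hmemA₁]; exact ⟨fun ht => ⟨hh, ht⟩, fun ht => ht.2⟩
  have hmemρ : ∀ h, χ (Additive.ofMul h) = 1 → (ρ * h ∈ T ↔ h ∉ A₀) := fun h hh => by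
    rw [hT, hmemA₀]; exact ⟨fun ht hA => ht hA.2, fun hA ht => hA ⟨hh, ht⟩⟩
  have hmemργ : ∀ h, χ (Additive.ofMul h) = 1 → (ρ * γ * h ∈ T ↔ h ∉ A₁) := fun h hh => by
    rw [mul_assoc, hT, hmemA₁]; exact ⟨fun ht hA => ht hA.2, fun hA ht => hA ⟨hh, ht⟩⟩
  by_cases huu : u₀ = u₁
  · -- `v = u₀` stabilises `A₀` and `A₁`, hence `T`
    refine finish u₀ hu₀1 hu₀u₀ fun z hz => ?_
    obtain ⟨a, h, ha, hh, rfl⟩ := hdecomp z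
    have hhu : χ (Additive.ofMul (u₀ * h)) = 1 := by rw [hχmul, hχu₀, hh, one_mul]
    rw [mul_left_comm]
    -- `u₀` preserves `A₀`, `A₁` and (being an involution) their complements in the kernel
    have hpres₀ : h ∈ A₀ ↔ u₀ * h ∈ A₀ :=
      ⟨hu₀A h, fun h' => by have := hu₀A _ h'; rwa [← mul_assoc, hu₀u₀, one_mul] at this⟩
    have hpres₁ : h ∈ A₁ ↔ u₀ * h ∈ A₁ :=
      ⟨huu ▸ hu₁A h, fun h' => by have := (huu ▸ hu₁A) _ h'; rwa [← mul_assoc, hu₀u₀, one_mul] at this⟩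
    rcases ha with ha | ha | ha | ha <;> rw [ha] at hz ⊢
    · exact (hmem1 _ hhu).2 (hpres₀.1 ((hmem1 h hh).1 hz))
    · exact (hmemγ _ hhu).2 (hpres₁.1 ((hmemγ h hh).1 hz))
    · exact (hmemρ _ hhu).2 (fun h' => (hmemρ h hh).1 hz (hpres₀.2 h'))
    · exact (hmemργ _ hhu).2 (fun h' => (hmemργ h hh).1 hz (hpres₁.2 h'))
  · -- `x = u₀ u₁` exchanges `Aᵢ` and `ker ∖ Aᵢ`; `v = ρ x`
    set x := u₀ * u₁ with hx
    have hχx : χ (Additive.ofMul x) = 1 := by rw [hx, hχmul, hχu₀, hχu₁, one_mul]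
    have hxx : x * x = 1 := by rw [hx, mul_mul_mul_comm, hu₀u₀, hu₁u₁, one_mul]
    have hu₀inv : u₀⁻¹ = u₀ := inv_eq_of_mul_eq_one_right hu₀u₀
    have hu₁inv : u₁⁻¹ = u₁ := inv_eq_of_mul_eq_one_right hu₁u₁
    have hx1 : x ≠ 1 := fun h => huu (by rw [← hu₁inv]; exact eq_inv_of_mul_eq_one_left h)
    have hxu₀ : x ≠ u₀ := fun h => hu₁1 (mul_left_cancel (a := u₀) (by rw [← hx, h, mul_one]))
    have hxu₁ : x ≠ u₁ := fun h => hu₀1 (mul_right_cancel (b := u₁) (by rw [← hx, h, one_mul]))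
    -- `x Aᵢ = ker ∖ Aᵢ`: off by the `F₂²`-lemma, onto by counting inside the kernel of order `4`
    have hswap : ∀ (A : Finset G), A ⊆ Hf → A.card = 2 → (∀ z ∈ A, x * z ∉ A) →
        ∀ h, χ (Additive.ofMul h) = 1 → (h ∈ A ↔ x * h ∉ A) := by
      intro A hAsub hA2 hoff h hh
      refine ⟨hoff h, fun hxh => ?_⟩
      by_contra hhA
      -- `h, xh ∈ ker ∖ A`, and `x A ⊆ ker ∖ A` has `2` elements: `ker ∖ A = x A`, so `h = x a`, `xh = a ∈ A`
      have himg : A.image (fun z => x * z) = Hf \ A := by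
        apply Finset.eq_of_subset_of_card_le
        · intro y hy
          obtain ⟨z, hz, rfl⟩ := Finset.mem_image.1 hy
          exact Finset.mem_sdiff.2 ⟨(hmemHf _).2 (by rw [hχmul, hχx, (hmemHf z).1 (hAsub hz), one_mul]),
            hoff z hz⟩
        · rw [Finset.card_sdiff_of_subset hAsub, hH4, hA2, Finset.card_image_of_injective _ (mul_right_injective x),
            hA2]
      have hmem : h ∈ Hf \ A := Finset.mem_sdiff.2 ⟨(hmemHf h).2 hh, hhA⟩
      rw [← himg] at hmem
      obtain ⟨z, hz, hzh⟩ := Finset.mem_image.1 hmem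
      apply hxh
      rw [← hzh, ← mul_assoc, hxx, one_mul]
      exact hz
    have hsw₀ := hswap A₀ (Finset.filter_subset _ _) hA₀2 (hu₀off x hx1 hxu₀)
    have hsw₁ := hswap A₁ (Finset.filter_subset _ _) hA₁2 (hu₁off x hx1 hxu₁)
    refine finish (ρ * x) (fun h => ?_) (by rw [mul_mul_mul_comm, hρ2, hxx, one_mul]) fun z hz => ?_
    · have : χ (Additive.ofMul (ρ * x)) = 1 := by rw [h, ofMul_one, AddChar.map_zero_eq_one]
      rw [hχmul, hχ, hχx] at this
      norm_num at this
    obtain ⟨a, h, ha, hh, rfl⟩ := hdecomp z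
    have hhx : χ (Additive.ofMul (x * h)) = 1 := by rw [hχmul, hχx, hh, one_mul]
    rcases ha with ha | ha | ha | ha <;> rw [ha] at hz ⊢
    · -- `z = h ∈ A₀` ⟹ `xh ∉ A₀` ⟹ `ρ (x h) ∈ T`
      rw [show ρ * x * (1 * h) = ρ * (x * h) by rw [one_mul, mul_assoc]]
      exact (hmemρ _ hhx).2 ((hsw₀ h hh).1 ((hmem1 h hh).1 hz))
    · -- `z = γ h`, `h ∈ A₁` ⟹ `xh ∉ A₁` ⟹ `ργ(xh) ∈ T`
      rw [show ρ * x * (γ * h) = ρ * γ * (x * h) by rw [mul_assoc, mul_left_comm x γ h, ← mul_assoc]]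
      exact (hmemργ _ hhx).2 ((hsw₁ h hh).1 ((hmemγ h hh).1 hz))
    · -- `z = ρ h`, `h ∉ A₀` ⟹ `xh ∈ A₀` ⟹ `x h ∈ T`
      rw [show ρ * x * (ρ * h) = 1 * (x * h) by rw [mul_mul_mul_comm, hρ2]]
      exact (hmem1 _ hhx).2 (by_contra fun hn => (hmemρ h hh).1 hz ((hsw₀ h hh).2 hn))
    · -- `z = ργ h`, `h ∉ A₁` ⟹ `xh ∈ A₁` ⟹ `γ (x h) ∈ T`
      rw [show ρ * x * (ρ * γ * h) = γ * (x * h) by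
        rw [mul_assoc ρ γ h, mul_mul_mul_comm, hρ2, one_mul, mul_left_comm]]
      exact (hmemγ _ hhx).2 (by_contra fun hn => (hmemργ h hh).1 hz ((hsw₁ h hh).2 hn))

/-! ## §6 The combined statement -/

omit [DecidableEq G] in
/-- **Order `16`, squares in `{1, ρ}`: every CM type equidistributed over an odd character has a non-trivial
stabiliser** (cases (A) `exists_stabiliser_of_sign_character` and (B) `exists_stabiliser_of_order_four_value`).
The abelian pairs concerned are `((ℤ/2)⁴, ρ)` and `(ℤ/4 × (ℤ/2)², ρ = (2,0,0))` — the two order-`16` exceptions in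
the classification of abelian `2`-groups all of whose primitive CM types are nondegenerate. [cite: Kubota1965, §4 Lemma 2] -/
theorem exists_stabiliser_sixteen [DecidableEq G] {ρ : G} {T : Finset G} (hT : ∀ g : G, ρ * g ∈ T ↔ g ∉ T)
    (hρ2 : ρ * ρ = 1) (hG : Fintype.card G = 16) (hsq : ∀ g : G, g * g = 1 ∨ g * g = ρ)
    (χ : AddChar (Additive G) ℂ) (hχ : χ (Additive.ofMul ρ) = -1)
    (hE : ∀ g : G, (T.filter fun s => χ (Additive.ofMul s) = χ (Additive.ofMul g)).card =
        (T.filter fun s => χ (Additive.ofMul s) = -χ (Additive.ofMul g)).card) :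
    ∃ v : G, v ≠ 1 ∧ ∀ z : G, z ∈ T ↔ v * z ∈ T := by
  by_cases hval : ∀ g : G, χ (Additive.ofMul g) = 1 ∨ χ (Additive.ofMul g) = -1
  · exact exists_stabiliser_of_sign_character hT hρ2 hG hsq χ hχ hval hE
  · push Not at hval
    obtain ⟨γ, hγ1, hγ2⟩ := hval
    exact exists_stabiliser_of_order_four_value hT hρ2 hG hsq χ hχ hγ1 hγ2 hE

end Summit.HodgeConjecture.CorCM.AbelianSixteen

end
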